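import Literature.Geometry.Symplectic.AlmostComplexTangentBundle
import Literature.Geometry.Riemannian.CurvatureAsDivergence
import HarnessLib

/-!
# Vector fields as sections of the complex tangent bundle `(TM, J)`

D. McDuff, D. Salamon, *Introduction to Symplectic Topology*, 3rd ed. (2017), §2.6–§2.7 (the tangent
bundle of an almost complex manifold as a complex vector bundle; Thm. 2.7.5: the first Chern number of
a line bundle over a surface is computed from the zeros of a section, read in trivialisations).  The
tree's model of `(TM, J)` is the `VectorBundleCore ℂ` `J.complexTangentCore`
(`AlmostComplexTangentBundle`), whose fibre at `x` is the model `ℂᵏ` identified with `T_x M = E` by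
`β_x = J.modelIsoAt x`, and whose trivialisation indexed by `x₀` reads a fibre vector at `x` through
`β_{x₀} C(x₀; x)⁻¹ Φ^{x₀}_x β_x⁻¹` (`C` the interpolating endomorphism, `Φ^{x₀}_x` the tangent
coordinate change).  This file supplies what the localisation formula for `c₁(TM, J)[M]` needs about
sections of this bundle coming from vector fields:

* `complexTangentCore_localTriv_apply_snd` — the trivialisation at `x₀` in closed form;
* `fieldSection J Y` (`x ↦ β_x (Y x)`), `localTriv_fieldSection` — a vector field `Y` as a section of
  `(TM, J)`; in the trivialisation at `x₀` it reads `β_{x₀} C(x₀; x)⁻¹ Φ^{x₀}_x (Y x)`;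
* `continuous_fieldSection` — continuity of the section for a continuous vector field (through
  Mathlib's `FiberBundle.continuousAt_section` on both bundles);
* `localTriv_fieldSection_extChartAt_symm` — read through the chart at `x₀`, the trivialised section
  is `β_{x₀} C(x₀; ·)⁻¹` applied to the chart representative `vectorRep I x₀ Y` of the field
  (`CurvatureAsDivergence`), near `φ(x₀)`;
* `hasFDerivAt_clm_apply_of_eq_zero` — calculus lemma: `x ↦ K(x) u(x)` has derivative `K(x₀) ∘ Du(x₀)`
  at a zero `x₀` of `u` as soon as `K` is CONTINUOUS at `x₀` (no differentiability of `K` needed);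
  hence (`hasFDerivAt_localTriv_fieldSection`) at a zero `x₀` of `Y` the trivialised section has
  derivative `β_{x₀} ∘ D(vectorRep Y)(φ x₀)` (`C(x₀; x₀) = 1`).

Everything is proved; no named facts.

## References

* [McDuffSalamon2017] D. McDuff, D. Salamon, Introduction to Symplectic Topology, 3rd ed., OUP 2017,
  §2.6, §2.7 Thm. 2.7.5.
* [HusemollerFibreBundles1994] D. Husemoller, Fibre Bundles, 3rd ed., GTM 20, Springer 1994, Ch. 3 §2.
-/

noncomputable section

open scoped Manifold ContDiff Topology
open Set Function Filter Module Bundle Asymptotics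

namespace Literature.Geometry.Symplectic

/-! ### A calculus lemma: `D(K·u)(x₀) = K(x₀) ∘ Du(x₀)` at a zero of `u`, for `K` merely continuous -/

section Calculus

variable {𝕜 : Type*} [NontriviallyNormedField 𝕜] {X : Type*} [NormedAddCommGroup X] [NormedSpace 𝕜 X]
  {V : Type*} [NormedAddCommGroup V] [NormedSpace 𝕜 V] {W : Type*} [NormedAddCommGroup W] [NormedSpace 𝕜 W]

/-- **`x ↦ K(x) u(x)` is differentiable at a zero `x₀` of `u` with derivative `K(x₀) ∘ Du(x₀)` as soon
as `K` is continuous at `x₀`**: `K(x) u(x) - K(x₀) Du(x₀)(x - x₀) = (K(x) - K(x₀)) u(x) + K(x₀)(u(x) - Du(x₀)(x - x₀))`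
with `u(x) = O(x - x₀)` and `K(x) - K(x₀) → 0`. [folklore] -/
theorem hasFDerivAt_clm_apply_of_eq_zero {K : X → V →L[𝕜] W} {u : X → V} {x₀ : X} {L : X →L[𝕜] V}
    (hK : ContinuousAt K x₀) (hu : HasFDerivAt u L x₀) (hu0 : u x₀ = 0) :
    HasFDerivAt (fun x ↦ K x (u x)) ((K x₀).comp L) x₀ := by
  rw [hasFDerivAt_iff_isLittleO] at hu ⊢
  replace hu : (fun x ↦ u x - L (x - x₀)) =o[𝓝 x₀] fun x ↦ x - x₀ := by simpa only [hu0, sub_zero] using hu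
  -- `u = O(x - x₀)`
  have huO : (fun x ↦ u x) =O[𝓝 x₀] fun x ↦ x - x₀ := by
    have h1 : (fun x ↦ L (x - x₀)) =O[𝓝 x₀] fun x ↦ x - x₀ :=
      IsBigO.of_bound ‖L‖ (Eventually.of_forall fun x ↦ L.le_opNorm _)
    simpa using hu.isBigO.add h1
  -- the first term `(K x - K x₀) (u x)` is `o(x - x₀)`
  have hA : (fun x ↦ (K x - K x₀) (u x)) =o[𝓝 x₀] fun x ↦ x - x₀ := by
    have hK0 : (fun x ↦ K x - K x₀) =o[𝓝 x₀] fun _ ↦ (1 : ℝ) := by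
      rw [isLittleO_one_iff]
      simpa using hK.tendsto.sub_const (K x₀)
    have h1 : (fun x ↦ (K x - K x₀) (u x)) =O[𝓝 x₀] fun x ↦ ‖K x - K x₀‖ * ‖u x‖ :=
      IsBigO.of_bound 1 (Eventually.of_forall fun x ↦ by
        rw [one_mul, Real.norm_of_nonneg (mul_nonneg (norm_nonneg _) (norm_nonneg _))]
        exact (K x - K x₀).le_opNorm (u x))
    have h2 := h1.trans_isLittleO (hK0.norm_left.mul_isBigO huO.norm_norm)
    simp only [one_mul] at h2
    exact h2.of_norm_right
  -- the second term `K x₀ (u x - L (x - x₀))` is `o(x - x₀)`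
  have hB : (fun x ↦ K x₀ (u x - L (x - x₀))) =o[𝓝 x₀] fun x ↦ x - x₀ := by
    refine (IsBigO.of_bound ‖K x₀‖ ?_).trans_isLittleO hu
    exact Eventually.of_forall fun x ↦ (K x₀).le_opNorm _
  refine (hA.add hB).congr_left fun x ↦ ?_
  simp only [sub_apply, ContinuousLinearMap.comp_apply, map_sub, hu0, map_zero, sub_zero]
  abel

end Calculus

/-! ### Sections of the complex tangent bundle attached to vector fields -/

namespace AlmostComplexStructure

variable {E : Type*} [NormedAddCommGroup E] [NormedSpace ℝ E] [FiniteDimensional ℝ E]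
  {H : Type*} [TopologicalSpace H] {I : ModelWithCorners ℝ E H}
  {M : Type*} [TopologicalSpace M] [ChartedSpace H M] [IsManifold I 1 M] {n : WithTop ℕ∞}
  (J : AlmostComplexStructure I n M)

/-- **The trivialisation of `(TM, J)` indexed by `x₀`, in closed form**: a fibre vector `v` at
`x ∈ U_{x₀}` reads `β_{x₀} C(x₀; x)⁻¹ Φ^{x₀}_x β_x⁻¹ v`. [cite: McDuffSalamon2017, §2.6] -/
theorem complexTangentCore_localTriv_apply_snd {x₀ x : M} (hx : x ∈ J.cBaseSet x₀)
    (v : J.complexTangentCore.Fiber x) :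
    (J.complexTangentCore.localTriv x₀ ⟨x, v⟩).2 =
      J.modelIsoAt x₀ (Ring.inverse (J.interpAt x₀ x) (tangentCoordChange I x x₀ x ((J.modelIsoAt x).symm v))) := by
  rw [VectorBundleCore.localTriv_apply]
  change J.cCoordChange x x₀ x v = _
  rw [cCoordChange_apply J (J.mem_cBaseSet_self x) hx, transModel_apply, realTrans, interpAt_self, mul_one]
  rfl

/-- **The section `x ↦ β_x (Y x)` of `(TM, J)` attached to a vector field `Y`.** [cite: McDuffSalamon2017, §2.7] -/
def fieldSection (Y : Π x : M, TangentSpace I x) (x : M) : J.complexTangentCore.Fiber x := J.modelIsoAt x (Y x)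

/-- `fieldSection J Y x = β_x (Y x)`. [folklore] -/
theorem fieldSection_apply (Y : Π x : M, TangentSpace I x) (x : M) : J.fieldSection Y x = J.modelIsoAt x (Y x) := rfl

/-- The section vanishes exactly where the field does. [folklore] -/
theorem fieldSection_eq_zero_iff (Y : Π x : M, TangentSpace I x) (x : M) : J.fieldSection Y x = 0 ↔ Y x = 0 :=
  (J.modelIsoAt x).map_eq_zero_iff

/-- **The section of a vector field in the trivialisation at `x₀`**: `β_{x₀} C(x₀; x)⁻¹ Φ^{x₀}_x (Y x)`.
[cite: McDuffSalamon2017, §2.7] -/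
theorem localTriv_fieldSection {x₀ x : M} (hx : x ∈ J.cBaseSet x₀) (Y : Π x : M, TangentSpace I x) :
    (J.complexTangentCore.localTriv x₀ ⟨x, J.fieldSection Y x⟩).2 =
      J.modelIsoAt x₀ (Ring.inverse (J.interpAt x₀ x) (tangentCoordChange I x x₀ x (Y x))) := by
  rw [complexTangentCore_localTriv_apply_snd J hx, fieldSection_apply, ContinuousLinearEquiv.symm_apply_apply]

/-- `x ↦ C(x₀; x)⁻¹` is continuous at `x₀` (where `C = 1`). [folklore] -/
theorem continuousAt_inverse_interpAt (x₀ : M) : ContinuousAt (fun x ↦ Ring.inverse (J.interpAt x₀ x)) x₀ := by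
  haveI : CompleteSpace E := FiniteDimensional.complete ℝ E
  have h1 : ContinuousAt (J.interpAt x₀) x₀ :=
    (continuousOn_interpAt J x₀).continuousAt ((isOpen_extChartAt_source x₀).mem_nhds (mem_extChartAt_source x₀))
  have h2 : ContinuousAt Ring.inverse (J.interpAt x₀ x₀) := by
    rw [interpAt_self]
    simpa using NormedRing.inverse_continuousAt (1 : (E →L[ℝ] E)ˣ)
  exact h2.comp h1

/-- **A continuous vector field gives a continuous section of `(TM, J)`.** [cite: McDuffSalamon2017, §2.7] -/
theorem continuous_fieldSection {Y : Π x : M, TangentSpace I x}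
    (hY : Continuous fun x ↦ (⟨x, Y x⟩ : TangentBundle I M)) :
    Continuous fun x ↦
      (⟨x, J.fieldSection Y x⟩ : TotalSpace (Fin (finrank ℝ E / 2) → ℂ) J.complexTangentCore.Fiber) := by
  refine continuous_iff_continuousAt.2 fun x₀ ↦ ?_
  refine (FiberBundle.continuousAt_section (Fin (finrank ℝ E / 2) → ℂ) x₀).2 ?_
  have hY' : ContinuousAt (fun x ↦ (trivializationAt E (TangentSpace I) x₀ ⟨x, Y x⟩).2) x₀ :=
    (FiberBundle.continuousAt_section E x₀).1 hY.continuousAt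
  have h : ContinuousAt
      (fun x ↦ J.modelIsoAt x₀ (Ring.inverse (J.interpAt x₀ x) (tangentCoordChange I x x₀ x (Y x)))) x₀ :=
    (J.modelIsoAt x₀).continuous.continuousAt.comp ((continuousAt_inverse_interpAt J x₀).clm_apply hY')
  refine h.congr ?_
  filter_upwards [(J.isOpen_cBaseSet x₀).mem_nhds (J.mem_cBaseSet_self x₀)] with x hx
  exact (localTriv_fieldSection J hx Y).symm

/-- **Read through the chart at `x₀`, the trivialised section is `β_{x₀} C(x₀; ·)⁻¹` of the chart
representative of the field**, near `φ x₀`: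
`(e_{x₀} (s_Y (φ⁻¹ x'))).2 = β_{x₀} C(x₀; φ⁻¹ x')⁻¹ (vectorRep I x₀ Y x')`. [cite: McDuffSalamon2017, Thm. 2.7.5] -/
theorem localTriv_fieldSection_extChartAt_symm [I.Boundaryless] (x₀ : M) (Y : Π x : M, TangentSpace I x) :
    (fun x' ↦ (J.complexTangentCore.localTriv x₀
        ⟨(extChartAt I x₀).symm x', J.fieldSection Y ((extChartAt I x₀).symm x')⟩).2) =ᶠ[𝓝 (extChartAt I x₀ x₀)]
      fun x' ↦ J.modelIsoAt x₀ (Ring.inverse (J.interpAt x₀ ((extChartAt I x₀).symm x'))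
        (Riemannian.vectorRep I x₀ Y x')) := by
  filter_upwards [extChartAt_target_mem_nhds (I := I) x₀,
    extChartAt_preimage_mem_nhds (I := I) ((J.isOpen_cBaseSet x₀).mem_nhds (J.mem_cBaseSet_self x₀))] with x' hx' hxb
  rw [mem_preimage] at hxb
  rw [localTriv_fieldSection J hxb Y]
  congr 2
  -- `Φ^{x₀}_x (Y x) = vectorRep I x₀ Y (φ x)` for `x = φ⁻¹ x'`
  have hxs : (extChartAt I x₀).symm x' ∈ (chartAt H x₀).source := by
    rw [← extChartAt_source I]
    exact (extChartAt I x₀).map_target hx'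
  rw [Riemannian.vectorRep_apply]
  have h1 := DFunLike.congr_fun (TangentBundle.continuousLinearMapAt_trivializationAt (I := I) hxs)
    (Y ((extChartAt I x₀).symm x'))
  rw [Trivialization.continuousLinearMapAt_apply_of_mem (R := ℝ) _
    (by simpa only [TangentBundle.trivializationAt_baseSet] using hxs)] at h1
  exact h1

/-- **The derivative of the trivialised section at a zero of the field**: if `Y x₀ = 0` and the chart
representative of `Y` has derivative `L` at `φ x₀`, the section read in the trivialisation at `x₀`
and the chart at `x₀` has derivative `β_{x₀} ∘ L` there (`C(x₀; x₀) = 1`). [cite: McDuffSalamon2017, Thm. 2.7.5] -/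
theorem hasFDerivAt_localTriv_fieldSection [I.Boundaryless] (x₀ : M) {Y : Π x : M, TangentSpace I x}
    (hY0 : Y x₀ = 0) {L : E →L[ℝ] E} (hL : HasFDerivAt (Riemannian.vectorRep I x₀ Y) L (extChartAt I x₀ x₀)) :
    HasFDerivAt (fun x' ↦ (J.complexTangentCore.localTriv x₀
        ⟨(extChartAt I x₀).symm x', J.fieldSection Y ((extChartAt I x₀).symm x')⟩).2)
      ((J.modelIsoAt x₀ : E →L[ℝ] (Fin (finrank ℝ E / 2) → ℂ)).comp L) (extChartAt I x₀ x₀) := by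
  refine HasFDerivAt.congr_of_eventuallyEq ?_ (localTriv_fieldSection_extChartAt_symm J x₀ Y)
  -- `x' ↦ C(x₀; φ⁻¹ x')⁻¹` is continuous at `φ x₀` with value `1`
  have hK : ContinuousAt (fun x' ↦ Ring.inverse (J.interpAt x₀ ((extChartAt I x₀).symm x'))) (extChartAt I x₀ x₀) := by
    have h := continuousAt_inverse_interpAt J x₀
    exact h.comp_of_eq (continuousAt_extChartAt_symm x₀) (extChartAt_to_inv x₀)
  have hu0 : Riemannian.vectorRep I x₀ Y (extChartAt I x₀ x₀) = 0 := by
    rw [Riemannian.vectorRep_apply, extChartAt_to_inv, hY0]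
    exact map_zero _
  have h1 := hasFDerivAt_clm_apply_of_eq_zero hK hL hu0
  rw [extChartAt_to_inv, interpAt_self, Ring.inverse_one, ContinuousLinearMap.one_def,
    ContinuousLinearMap.id_comp] at h1
  exact (J.modelIsoAt x₀ : E →L[ℝ] (Fin (finrank ℝ E / 2) → ℂ)).hasFDerivAt.comp (extChartAt I x₀ x₀) h1

end AlmostComplexStructure

end Literature.Geometry.Symplectic
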